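import Summits.HodgeConjecture.HodgeConjecture.Theorems.F0P3cStCharTSOffStratumH   -- ★ p849417-cone (LH6-p04 (g2)): §1 shell pattern through `E : G →* GL₂`, `charpoly_fin_two_coeff`, `exists_coe_eq_of_mem_doubleCoset`; brings ★ `F0P3cStCharTSOffStratumVal.valuation_charpoly_coeff_shell_two`, ★ `coe_localNonsplitEquiv_eq_map`
import HarnessLib

/-!
# F0 · P3c · line LH6 «StCharTS» — road (D) «DEEP-FL», brick ③ «SHELL-ON + FLIP-OFF★»: (a) a deep double coset `K₂ u₂ K₂` of ANY hyperbolic diagonal `u₂ ∈ U(Φ₂)(L⁺_v)`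
# (either orientation) is ON the stratum (`|det x|_w < |tr x|_w²`); (b) along an oriented `hlevi` stratum the torus point never lies in an ANTI-oriented coset `u′_j · S′`
# [Rogawski1990 §4.3 p. 42; §12.7 L. 12.7.3 (proof) p. 195]

Cell `pub/hodgecm-mathlib`, crux H413 = `stmt-HodgeConjecture-24833` (`--supports` lane, helper), route HCCMUnconditional; seat F0P2-p02 (g15); deal ③ of the road (D) owner
LH6-p04 (g3) 2026-09-02T06:33:10Z (re-dealt from LH10-p02 (g3)); spec ROAD-D v7 `F0/P3b/LH6-p04/g3/ROAD-D.status.v7.txt` 7d68ee6667d2d4d5, § KERNEL CHAIN: `hfHon ⇐ … + ③(a)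
«SHELL-ON★»`, `hflip ⇐ ③(b) «FLIP-OFF★»`.  TARGETS = hypotheses of ★ p849876 `F0P3cStCharTSTransferChecklist.isLocalDeltaTransfer_doubleCosetSum_of_checklist` (`hfHon` body, `hflip`
VERBATIM).  THEOREMS ONLY, sorry-free, ★-only imports; no definition ∕ instance ∕ notation ∕ named fact.

* §1 VALUATION ALGEBRA (any valued field `(K, v)`): for `k₁, k₂` of level `r < 1` and a HYPERBOLIC diagonal `d` (`v(d₀) ≠ v(d₁)`, `v(d₀) v(d₁) = 1`, EITHER orientation)
  `v(det(k₁ D k₂)) = 1 < v(tr(k₁ D k₂))²` (`valuation_det_lt_trace_sq_shell_two`; oriented case = ★ `valuation_charpoly_coeff_shell_two`, the other orientation by the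
  `(0 1)`-reindexing, which preserves the level, `det`, and `tr`); through a hom `E : G →* GL₂(K)`: every `x ∈ K_n u K_n` with `E u = diag(d)` is ON
  (`valuation_det_lt_trace_sq_of_mem_doubleCoset`).  This generalises ★ `F0P3cStCharTSOffStratumH` §1 off the ray `z·aᵐ`.
* §2 `fst_mem_doubleCoset_of_mem_doubleCoset_prod` — `x ∈ (K₂ × K₁)(u₂, u₁)(K₂ × K₁) ⇒ x.1 ∈ K₂ u₂ K₂` (any groups).
* §3 «SHELL-ON★» ON THE CM CARRIERS: **`valued_det_lt_trace_sq_of_mem_doubleCoset_hyperbolic`** — `K₂ ≤ U(Φ₂)(L⁺_v)` of level `r < 1` at `w` (the `hK₂` text of ★ p849417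
  `F0P3cStCharTSOffStratumCM`), `E₂ u₂ = diag(e₀, e₁)` with `|e₀|_w ≠ |e₁|_w`, `|e₀|_w |e₁|_w = 1` ⇒ every `x ∈ K₂ u₂ K₂` is ON in the `Pi.evalRingHom _ w` spelling of ★ p849833's
  `hfHon`; **`valued_det_lt_trace_sq_fst_of_mem_doubleCoset_prod`** — the PRODUCT form for `K_H = K₂.prod K₁`, `u = (u₂, u₁)`: `x ∈ K_H u K_H ⇒ ON(x.1)`.
* §4 «FLIP-OFF★»: **`hflip_of_antiOriented`** — the `hflip` hypothesis of ★ p849876 VERBATIM, from: `C′ j = u′ j • S′` (left cosets in `T₂ × U(Φ₁)_v`), every `u′ j` ANTI-oriented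
  (`|e₀|_w < |e₁|_w` for the diagonal `e` of `(u′ j).1`) and `S′` inside the unit box (`|eᵢ − 1|_w < 1` for the diagonal of `k.1`, `k ∈ S′`): a point `(tH, γH.2) ∈ C′ j` has
  `tH = (u′ j).1 · k.1`, diagonal entries multiply (`coe_apply_eq_mul_of_glDiagonal_mul`), box entries have valuation `1` (Mathlib `Valuation.map_one_add_of_lt`), so
  `|d′₀|_w = |e₀|_w < |e₁|_w = |d′₁|_w` — against `hlt : |d′₁|_w < |d′₀|_w`.  The head discharges anti-orientation from ORIENT ★ p849755 (Weyl flip of the oriented reps)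
  and the box from LEVEL-PICK ★.
HONEST LABEL: HC_CM is proved only modulo the 7 printed citations (2 remaining: hLiu418 = `stmt-HodgeConjecture-24832`, h413 = `stmt-HodgeConjecture-24833`) until rung 0 closes;
count-neutral road-(D) brick, closes no organ.

## References
* [Rogawski1990] J. D. Rogawski, *Automorphic Representations of Unitary Groups in Three Variables*, Ann. of Math. Stud. 123 (1990): §3.1 p. 19; §4.3 p. 42; §4.9 (4.9.4) p. 56;
  §12.7 Lemma 12.7.3 (proof) p. 195.
* [Casselman1995] W. Casselman, *Introduction to the theory of admissible representations of p-adic reductive groups* (1995 notes), Prop. 1.4.4, §1.5 (Iwahori factorisation,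
  shells `K t K`).
-/

set_option autoImplicit false
-- the mandated namespace has the single-problem summit's repeated segment (`HodgeConjecture.HodgeConjecture`)
set_option linter.dupNamespace false

noncomputable section

open Matrix Polynomial NumberField IsDedekindDomain
open scoped MatrixGroups Pointwise
open Literature.NumberTheory.Rogawski1990 Literature.NumberTheory.Automorphic Literature.NumberTheory.Automorphic.UnitaryGroup
open Literature.NumberTheory.GaloisRepresentations
open Summit.HodgeConjecture.HodgeConjecture.Cruxes.H413

namespace Summit.HodgeConjecture.HodgeConjecture.Cruxes.H413.F0P3cStCharTSShellOn

/-! ## §1 Valuation algebra: a deep double coset of ANY hyperbolic diagonal is ON (`v(det) < v(tr)²`) -/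

section Val

variable {K : Type*} [Field K] {Γ₀ : Type*} [LinearOrderedCommGroupWithZero Γ₀] (v : Valuation K Γ₀)

/-- **Oriented shell** `v(d₀) < v(d₁)`, `k₁, k₂` of level `r < 1`: `v(det(k₁ D k₂)) = v(d₀) v(d₁)` and `v(tr(k₁ D k₂)) = v(d₁)` (★ `valuation_charpoly_coeff_shell_two` + `coeff₁ = −tr`,
`coeff₀ = det`). [cite: Rogawski1990, §12.7 L. 12.7.3 (proof) p. 195] [cite: Casselman1995, Prop. 1.4.4, §1.5] -/
theorem valuation_det_trace_shell_two_of_lt (d : Fin 2 → K) (k₁ k₂ : Matrix (Fin 2) (Fin 2) K) {r : Γ₀} (hr : r < 1)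
    (hk₁ : ∀ i j, v (k₁ i j - (1 : Matrix (Fin 2) (Fin 2) K) i j) ≤ r) (hk₂ : ∀ i j, v (k₂ i j - (1 : Matrix (Fin 2) (Fin 2) K) i j) ≤ r)
    (h0 : v (d 0) ≠ 0) (h01 : v (d 0) < v (d 1)) :
    v (k₁ * diagonal d * k₂).det = v (d 0) * v (d 1) ∧ v (k₁ * diagonal d * k₂).trace = v (d 1) := by
  obtain ⟨h1, h0'⟩ := F0P3cStCharTSOffStratumVal.valuation_charpoly_coeff_shell_two v d k₁ k₂ hr hk₁ hk₂ h0 h01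
  obtain ⟨hc1, hc0⟩ := F0P3cStCharTSOffStratumH.charpoly_fin_two_coeff (k₁ * diagonal d * k₂)
  rw [hc1, Valuation.map_neg] at h1
  rw [hc0] at h0'
  exact ⟨h0', h1⟩

/-- **Anti-oriented shell** `v(d₁) < v(d₀)`: the same values with the indices swapped — the shell through `diag(d₀, d₁)` is the `(0 1)`-reindexing of the shell through
`diag(d₁, d₀)`; reindexing by a permutation preserves the level (`submatrix_one_equiv`), `det` (`det_submatrix_equiv_self`) and `tr`. [cite: Rogawski1990, §12.7 L. 12.7.3 (proof) p. 195] -/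
theorem valuation_det_trace_shell_two_of_gt (d : Fin 2 → K) (k₁ k₂ : Matrix (Fin 2) (Fin 2) K) {r : Γ₀} (hr : r < 1)
    (hk₁ : ∀ i j, v (k₁ i j - (1 : Matrix (Fin 2) (Fin 2) K) i j) ≤ r) (hk₂ : ∀ i j, v (k₂ i j - (1 : Matrix (Fin 2) (Fin 2) K) i j) ≤ r)
    (h1 : v (d 1) ≠ 0) (h10 : v (d 1) < v (d 0)) :
    v (k₁ * diagonal d * k₂).det = v (d 0) * v (d 1) ∧ v (k₁ * diagonal d * k₂).trace = v (d 0) := by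
  set e : Fin 2 ≃ Fin 2 := Equiv.swap 0 1 with he
  have he0 : e 0 = 1 := by rw [he, Equiv.swap_apply_left]
  have he1 : e 1 = 0 := by rw [he, Equiv.swap_apply_right]
  have hlev : ∀ k : Matrix (Fin 2) (Fin 2) K, (∀ i j, v (k i j - (1 : Matrix (Fin 2) (Fin 2) K) i j) ≤ r) →
      ∀ i j, v ((k.submatrix e e) i j - (1 : Matrix (Fin 2) (Fin 2) K) i j) ≤ r := by
    intro k hk i j
    rw [← submatrix_one_equiv e]
    exact hk (e i) (e j)
  have hprod : (k₁ * diagonal d * k₂).submatrix e e = k₁.submatrix e e * diagonal (d ∘ e) * k₂.submatrix e e := by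
    rw [← submatrix_diagonal_equiv, submatrix_mul_equiv, submatrix_mul_equiv]
  obtain ⟨hdet, htr⟩ := valuation_det_trace_shell_two_of_lt v (d ∘ e) (k₁.submatrix e e) (k₂.submatrix e e) hr (hlev k₁ hk₁) (hlev k₂ hk₂)
    (by rw [Function.comp_apply, he0]; exact h1) (by rw [Function.comp_apply, Function.comp_apply, he0, he1]; exact h10)
  rw [← hprod, det_submatrix_equiv_self] at hdet
  rw [← hprod] at htr
  have htr' : ((k₁ * diagonal d * k₂).submatrix e e).trace = (k₁ * diagonal d * k₂).trace := by
    rw [trace_fin_two, trace_fin_two, submatrix_apply, submatrix_apply, he0, he1, add_comm]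
  rw [htr'] at htr
  refine ⟨?_, ?_⟩
  · rw [hdet, Function.comp_apply, Function.comp_apply, he0, he1, mul_comm]
  · rw [htr, Function.comp_apply, he1]

/-- **HYPERBOLIC SHELL, EITHER ORIENTATION ⇒ ON.**  `v(d₀) ≠ v(d₁)`, `v(d₀) v(d₁) = 1`, `k₁, k₂` of level `r < 1` ⇒ `v(det(k₁ D k₂)) = 1 < v(tr(k₁ D k₂))²` (the larger of `v(d₀)`,
`v(d₁)` exceeds `1` and is `v(tr)`). [cite: Rogawski1990, §12.7 L. 12.7.3 (proof) p. 195] -/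
theorem valuation_det_lt_trace_sq_shell_two (d : Fin 2 → K) (k₁ k₂ : Matrix (Fin 2) (Fin 2) K) {r : Γ₀} (hr : r < 1)
    (hk₁ : ∀ i j, v (k₁ i j - (1 : Matrix (Fin 2) (Fin 2) K) i j) ≤ r) (hk₂ : ∀ i j, v (k₂ i j - (1 : Matrix (Fin 2) (Fin 2) K) i j) ≤ r)
    (hne : v (d 0) ≠ v (d 1)) (hprod : v (d 0) * v (d 1) = 1) :
    v (k₁ * diagonal d * k₂).det < v (k₁ * diagonal d * k₂).trace ^ 2 := by
  have h0 : v (d 0) ≠ 0 := left_ne_zero_of_mul_eq_one hprod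
  have h1 : v (d 1) ≠ 0 := right_ne_zero_of_mul_eq_one hprod
  rcases lt_or_gt_of_ne hne with hlt | hgt
  · obtain ⟨hdet, htr⟩ := valuation_det_trace_shell_two_of_lt v d k₁ k₂ hr hk₁ hk₂ h0 hlt
    rw [hdet, htr, hprod, sq]
    calc (1 : Γ₀) = v (d 0) * v (d 1) := hprod.symm
      _ < v (d 1) * v (d 1) := mul_lt_mul_of_pos_right hlt (zero_lt_iff.2 h1)
  · obtain ⟨hdet, htr⟩ := valuation_det_trace_shell_two_of_gt v d k₁ k₂ hr hk₁ hk₂ h1 hgt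
    rw [hdet, htr, hprod, sq]
    calc (1 : Γ₀) = v (d 0) * v (d 1) := hprod.symm
      _ < v (d 0) * v (d 0) := mul_lt_mul_of_pos_left hgt (zero_lt_iff.2 h0)

variable {G : Type*} [Group G] (E : G →* GL (Fin 2) K)

/-- **Through a hom `E : G →* GL₂(K)`**: if `K_n ≤ G` has level `r < 1` under `E` and `E u = diag(d)` is hyperbolic (`v(d₀) ≠ v(d₁)`, `v(d₀) v(d₁) = 1`), every `x ∈ K_n u K_n` has
`v(det E x) < v(tr E x)²` (`E x = E k₁ · diag(d) · E k₂`, ★ `exists_coe_eq_of_mem_doubleCoset`). [cite: Rogawski1990, §12.7 L. 12.7.3 (proof) p. 195] -/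
theorem valuation_det_lt_trace_sq_of_mem_doubleCoset (Kn : Subgroup G) {r : Γ₀} (hr : r < 1)
    (hK : ∀ k ∈ Kn, ∀ i j, v (((E k : GL (Fin 2) K) : Matrix (Fin 2) (Fin 2) K) i j - (1 : Matrix (Fin 2) (Fin 2) K) i j) ≤ r)
    {u : G} {d : Fin 2 → K} (hu : ((E u : GL (Fin 2) K) : Matrix (Fin 2) (Fin 2) K) = diagonal d)
    (hne : v (d 0) ≠ v (d 1)) (hprod : v (d 0) * v (d 1) = 1)
    {x : G} (hx : x ∈ DoubleCoset.doubleCoset u (Kn : Set G) Kn) :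
    v ((E x : GL (Fin 2) K) : Matrix (Fin 2) (Fin 2) K).det < v ((E x : GL (Fin 2) K) : Matrix (Fin 2) (Fin 2) K).trace ^ 2 := by
  obtain ⟨k₁, hk₁, k₂, hk₂, hxe⟩ := F0P3cStCharTSOffStratumH.exists_coe_eq_of_mem_doubleCoset E Kn Kn u hx
  rw [hxe, hu]
  exact valuation_det_lt_trace_sq_shell_two v d _ _ hr (hK k₁ hk₁) (hK k₂ hk₂) hne hprod

end Val

/-! ## §2 Product projection of double cosets -/

section Prod

variable {G H : Type*} [Group G] [Group H]

/-- **Product projection of double cosets**: for `K_H = K₂ × K₁ ≤ G × H` and `u = (u₂, u₁)`, `x ∈ K_H u K_H ⇒ x.1 ∈ K₂ u₂ K₂`. [folklore] -/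
theorem fst_mem_doubleCoset_of_mem_doubleCoset_prod (K₂ : Subgroup G) (K₁ : Subgroup H) (u : G × H) {x : G × H}
    (hx : x ∈ DoubleCoset.doubleCoset u ((K₂.prod K₁ : Subgroup (G × H)) : Set (G × H)) (K₂.prod K₁ : Subgroup (G × H))) :
    x.1 ∈ DoubleCoset.doubleCoset u.1 (K₂ : Set G) K₂ := by
  obtain ⟨k, hk, k', hk', rfl⟩ := DoubleCoset.mem_doubleCoset.1 hx
  exact DoubleCoset.mem_doubleCoset.2 ⟨k.1, (Subgroup.mem_prod.1 hk).1, k'.1, (Subgroup.mem_prod.1 hk').1, rfl⟩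

end Prod

/-! ## §3 «SHELL-ON★» on the CM carriers `U(Φ₂)(L⁺_v)` and `H_v = U(Φ₂) × U(Φ₁)` -/

section CM

variable (L : Type) [Field L] [NumberField L] [IsCMField L] (v : HeightOneSpectrum (𝓞 ↥(maximalRealSubfield L)))
  (w : PlacesOver L v) (hw : IsCMField.complexConj L • w.1 = w.1)

set_option maxHeartbeats 800000 in  -- statement-level `whnf` on the CM carriers
/-- **«SHELL-ON★» (a) ON THE CM CARRIERS.**  `U₂ = U(Φ₂)(L⁺_v)` (★ `cmDatum L 2 Φ₂`), `E₂ = localNonsplitEquiv` at `(w, hw)`; `K₂ ≤ U₂` of LEVEL `r < 1` under `E₂` (the `hK₂` text of ★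
`F0P3cStCharTSOffStratumCM.conj_notMem_tsupport_of_not_on_H`); `u₂ ∈ U₂` with `E₂ u₂ = diag(e₀, e₁)` HYPERBOLIC OF EITHER ORIENTATION (`|e₀|_w ≠ |e₁|_w`, `|e₀|_w |e₁|_w = 1`).
Then every `x ∈ K₂ u₂ K₂` is ON the stratum: `|det x|_w < |tr x|_w²`, in the `Pi.evalRingHom _ w` spelling of ★ p849833's `hfHon` (bridge `E₂ x = x.map ev_w`, ★
`coe_localNonsplitEquiv_eq_map`).  Generalises ★ `F0P3cStCharTSOffStratumH.valued_det_lt_trace_sq_of_isLocalStablyConjH_of_conj_mem_shell` off the ray `z·aᵐ`.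
[cite: Rogawski1990, §4.3 p. 42; §12.7 L. 12.7.3 (proof) p. 195] -/
theorem valued_det_lt_trace_sq_of_mem_doubleCoset_hyperbolic
    (K₂ : Subgroup ((cmDatum L 2 (Matrix.of fun i j : Fin 2 => if i.val + j.val + 1 = 2 then (1 : L) else 0)).Local v)) {r : WithZero (Multiplicative ℤ)} (hr : r < 1)
    (hK : ∀ k ∈ K₂, ∀ i j, Valued.v ((((localNonsplitEquiv (IsCMField.complexConj L) (Matrix.of fun i j : Fin 2 => if i.val + j.val + 1 = 2 then (1 : L) else 0)
        (IsCMField.complexConj_ne_one L) w hw k :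
        ↥(unitaryGroupOfForm (galAdicCompletionMap (L := L) (IsCMField.complexConj L) hw) (placeForm (Matrix.of fun i j : Fin 2 => if i.val + j.val + 1 = 2 then (1 : L) else 0) w.1))) :
        GL (Fin 2) (w.1.adicCompletion L)) : Matrix (Fin 2) (Fin 2) (w.1.adicCompletion L)) i j - (1 : Matrix (Fin 2) (Fin 2) (w.1.adicCompletion L)) i j) ≤ r)
    {u₂ : (cmDatum L 2 (Matrix.of fun i j : Fin 2 => if i.val + j.val + 1 = 2 then (1 : L) else 0)).Local v} {e₀ e₁ : w.1.adicCompletion L}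
    (hu : (((localNonsplitEquiv (IsCMField.complexConj L) (Matrix.of fun i j : Fin 2 => if i.val + j.val + 1 = 2 then (1 : L) else 0) (IsCMField.complexConj_ne_one L) w hw u₂ :
        ↥(unitaryGroupOfForm (galAdicCompletionMap (L := L) (IsCMField.complexConj L) hw) (placeForm (Matrix.of fun i j : Fin 2 => if i.val + j.val + 1 = 2 then (1 : L) else 0) w.1))) :
        GL (Fin 2) (w.1.adicCompletion L)) : Matrix (Fin 2) (Fin 2) (w.1.adicCompletion L)) = Matrix.diagonal ![e₀, e₁])
    (hne : Valued.v e₀ ≠ Valued.v e₁) (hprod : Valued.v e₀ * Valued.v e₁ = 1)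
    {x : (cmDatum L 2 (Matrix.of fun i j : Fin 2 => if i.val + j.val + 1 = 2 then (1 : L) else 0)).Local v}
    (hx : x ∈ DoubleCoset.doubleCoset u₂ (K₂ : Set ((cmDatum L 2 (Matrix.of fun i j : Fin 2 => if i.val + j.val + 1 = 2 then (1 : L) else 0)).Local v)) K₂) :
    Valued.v ((Pi.evalRingHom (fun w' : PlacesOver L v => w'.1.adicCompletion L) w) ((x.val : GL (Fin 2) (LocalRing L v)) : Matrix (Fin 2) (Fin 2) (LocalRing L v)).det) <
      Valued.v ((Pi.evalRingHom (fun w' : PlacesOver L v => w'.1.adicCompletion L) w) ((x.val : GL (Fin 2) (LocalRing L v)) : Matrix (Fin 2) (Fin 2) (LocalRing L v)).trace) ^ 2 := by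
  set ev := Pi.evalRingHom (fun w' : PlacesOver L v => w'.1.adicCompletion L) w with hev
  set σw := galAdicCompletionMap (L := L) (IsCMField.complexConj L) hw with hσw
  set E : (cmDatum L 2 (Matrix.of fun i j : Fin 2 => if i.val + j.val + 1 = 2 then (1 : L) else 0)).Local v →* GL (Fin 2) (w.1.adicCompletion L) :=
    (unitaryGroupOfForm σw (placeForm (Matrix.of fun i j : Fin 2 => if i.val + j.val + 1 = 2 then (1 : L) else 0) w.1)).subtype.comp
      (localNonsplitEquiv (IsCMField.complexConj L) (Matrix.of fun i j : Fin 2 => if i.val + j.val + 1 = 2 then (1 : L) else 0) (IsCMField.complexConj_ne_one L) w hw).toMonoidHom with hE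
  have hEapply : ∀ g, ((E g : GL (Fin 2) (w.1.adicCompletion L)) : Matrix (Fin 2) (Fin 2) (w.1.adicCompletion L)) =
      (((localNonsplitEquiv (IsCMField.complexConj L) (Matrix.of fun i j : Fin 2 => if i.val + j.val + 1 = 2 then (1 : L) else 0) (IsCMField.complexConj_ne_one L) w hw g :
        ↥(unitaryGroupOfForm σw (placeForm (Matrix.of fun i j : Fin 2 => if i.val + j.val + 1 = 2 then (1 : L) else 0) w.1))) : GL (Fin 2) (w.1.adicCompletion L)) : Matrix (Fin 2) (Fin 2) (w.1.adicCompletion L)) :=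
    fun g => rfl
  have hK' : ∀ k ∈ K₂, ∀ i j, Valued.v (((E k : GL (Fin 2) (w.1.adicCompletion L)) : Matrix (Fin 2) (Fin 2) (w.1.adicCompletion L)) i j -
      (1 : Matrix (Fin 2) (Fin 2) (w.1.adicCompletion L)) i j) ≤ r := fun k hk i j => by rw [hEapply]; exact hK k hk i j
  have hu' : ((E u₂ : GL (Fin 2) (w.1.adicCompletion L)) : Matrix (Fin 2) (Fin 2) (w.1.adicCompletion L)) = diagonal ![e₀, e₁] := by
    rw [hEapply]; exact hu
  have hlt := valuation_det_lt_trace_sq_of_mem_doubleCoset Valued.v E K₂ hr hK' hu' (by simpa using hne) (by simpa using hprod) hx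
  set M₂ : Matrix (Fin 2) (Fin 2) (w.1.adicCompletion L) := (((x.val : GL (Fin 2) (LocalRing L v)) : Matrix (Fin 2) (Fin 2) (LocalRing L v)).map ev) with hM₂
  have hEx : ((E x : GL (Fin 2) (w.1.adicCompletion L)) : Matrix (Fin 2) (Fin 2) (w.1.adicCompletion L)) = M₂ := by
    rw [hEapply, coe_localNonsplitEquiv_eq_map]
  have htrace : M₂.trace = ev ((x.val : GL (Fin 2) (LocalRing L v)) : Matrix (Fin 2) (Fin 2) (LocalRing L v)).trace := by
    rw [hM₂, Matrix.trace, Matrix.trace, map_sum]; rfl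
  have hdet : M₂.det = ev ((x.val : GL (Fin 2) (LocalRing L v)) : Matrix (Fin 2) (Fin 2) (LocalRing L v)).det := by
    rw [hM₂, ← RingHom.mapMatrix_apply, ← RingHom.map_det]
  rw [← htrace, ← hdet, ← hEx]
  exact hlt

set_option maxHeartbeats 800000 in  -- statement-level `whnf` on the CM carriers
/-- **«SHELL-ON★» (a), PRODUCT FORM** — the shape ★ p849833's `hfHon` consumes per summand: for `K_H = K₂.prod K₁ ≤ H_v = U₂ × U(Φ₁)_v` and `u = (u₂, u₁)` with `u₂` a hyperbolic
diagonal under `E₂` (either orientation), every `x ∈ K_H u K_H` has `x.1` ON: `|det x.1|_w < |tr x.1|_w²`. [cite: Rogawski1990, §4.3 p. 42; §12.7 L. 12.7.3 (proof) p. 195] -/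
theorem valued_det_lt_trace_sq_fst_of_mem_doubleCoset_prod
    (K₂ : Subgroup ((cmDatum L 2 (Matrix.of fun i j : Fin 2 => if i.val + j.val + 1 = 2 then (1 : L) else 0)).Local v))
    (K₁ : Subgroup ((cmDatum L 1 (Matrix.of fun i j : Fin 1 => if i.val + j.val + 1 = 1 then (1 : L) else 0)).Local v))
    {r : WithZero (Multiplicative ℤ)} (hr : r < 1)
    (hK : ∀ k ∈ K₂, ∀ i j, Valued.v ((((localNonsplitEquiv (IsCMField.complexConj L) (Matrix.of fun i j : Fin 2 => if i.val + j.val + 1 = 2 then (1 : L) else 0)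
        (IsCMField.complexConj_ne_one L) w hw k :
        ↥(unitaryGroupOfForm (galAdicCompletionMap (L := L) (IsCMField.complexConj L) hw) (placeForm (Matrix.of fun i j : Fin 2 => if i.val + j.val + 1 = 2 then (1 : L) else 0) w.1))) :
        GL (Fin 2) (w.1.adicCompletion L)) : Matrix (Fin 2) (Fin 2) (w.1.adicCompletion L)) i j - (1 : Matrix (Fin 2) (Fin 2) (w.1.adicCompletion L)) i j) ≤ r)
    {u : (cmDatum L 2 (Matrix.of fun i j : Fin 2 => if i.val + j.val + 1 = 2 then (1 : L) else 0)).Local v ×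
      (cmDatum L 1 (Matrix.of fun i j : Fin 1 => if i.val + j.val + 1 = 1 then (1 : L) else 0)).Local v}
    {e₀ e₁ : w.1.adicCompletion L}
    (hu : (((localNonsplitEquiv (IsCMField.complexConj L) (Matrix.of fun i j : Fin 2 => if i.val + j.val + 1 = 2 then (1 : L) else 0) (IsCMField.complexConj_ne_one L) w hw u.1 :
        ↥(unitaryGroupOfForm (galAdicCompletionMap (L := L) (IsCMField.complexConj L) hw) (placeForm (Matrix.of fun i j : Fin 2 => if i.val + j.val + 1 = 2 then (1 : L) else 0) w.1))) :
        GL (Fin 2) (w.1.adicCompletion L)) : Matrix (Fin 2) (Fin 2) (w.1.adicCompletion L)) = Matrix.diagonal ![e₀, e₁])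
    (hne : Valued.v e₀ ≠ Valued.v e₁) (hprod : Valued.v e₀ * Valued.v e₁ = 1)
    {x : (cmDatum L 2 (Matrix.of fun i j : Fin 2 => if i.val + j.val + 1 = 2 then (1 : L) else 0)).Local v ×
      (cmDatum L 1 (Matrix.of fun i j : Fin 1 => if i.val + j.val + 1 = 1 then (1 : L) else 0)).Local v}
    (hx : x ∈ DoubleCoset.doubleCoset u ((K₂.prod K₁ : Subgroup _) : Set _) (K₂.prod K₁ : Subgroup _)) :
    Valued.v ((Pi.evalRingHom (fun w' : PlacesOver L v => w'.1.adicCompletion L) w) ((x.1.val : GL (Fin 2) (LocalRing L v)) : Matrix (Fin 2) (Fin 2) (LocalRing L v)).det) <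
      Valued.v ((Pi.evalRingHom (fun w' : PlacesOver L v => w'.1.adicCompletion L) w) ((x.1.val : GL (Fin 2) (LocalRing L v)) : Matrix (Fin 2) (Fin 2) (LocalRing L v)).trace) ^ 2 :=
  valued_det_lt_trace_sq_of_mem_doubleCoset_hyperbolic L v w hw K₂ hr hK hu hne hprod (fst_mem_doubleCoset_of_mem_doubleCoset_prod K₂ K₁ u hx)

end CM

/-! ## §4 «FLIP-OFF★»: an oriented stratum point lies in no anti-oriented coset -/

section Flip

variable (L : Type) [Field L] [NumberField L] [IsCMField L] (v : HeightOneSpectrum (𝓞 ↥(maximalRealSubfield L)))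
  (w : PlacesOver L v) (hw : IsCMField.complexConj L • w.1 = w.1)

/-- Diagonal entries multiply: `glDiagonal c = glDiagonal a · glDiagonal b ⇒ cᵢ = aᵢ bᵢ` (any commutative ring, any size). [folklore] -/
theorem coe_apply_eq_mul_of_glDiagonal_mul {R : Type*} [CommRing R] {N : ℕ} {a b c : Fin N → Rˣ}
    (h : glDiagonal N R c = glDiagonal N R a * glDiagonal N R b) (i : Fin N) : (c i : R) = a i * b i := by
  have e := congrArg (fun g : GL (Fin N) R => (g : Matrix (Fin N) (Fin N) R) i i) h
  simpa [Units.val_mul, coe_glDiagonal, diagonal_apply_eq, diagonal_mul_diagonal] using e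

set_option maxHeartbeats 800000 in  -- statement-level `whnf` on the CM carriers
/-- **«FLIP-OFF★» (b)** — the `hflip` hypothesis of ★ p849876 `isLocalDeltaTransfer_doubleCosetSum_of_checklist`, VERBATIM as conclusion.  Hypotheses: the anti-oriented cosets are
`C′ j = u′ j • S′` (`j ∈ s`) for torus points `u′ j ∈ T₂ × U(Φ₁)_v` that are ANTI-ORIENTED at `w` (`|e₀|_w < |e₁|_w` for any diagonal `e` of `(u′ j).1`) and a subgroup `S′` inside the
UNIT BOX at `w` (`|eᵢ − 1|_w < 1` for any diagonal `e` of `k.1`, `k ∈ S′`).  Proof: `(tH, γH.2) = u′ j · k` forces `tH = (u′ j).1 · k.1`, diagonal entries multiply, box entries have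
valuation `1` (Mathlib `Valuation.map_one_add_of_lt`), so `|d′₀|_w = |e₀|_w < |e₁|_w = |d′₁|_w` — incompatible with the stratum's orientation `hlt : |d′₁|_w < |d′₀|_w`.  (The
`IsLocalGRegular` and `σ_w(d′₀) d′₁ = 1` binders of the text are idle here.) [cite: Rogawski1990, §4.9 (4.9.4) p. 56; §12.7 L. 12.7.3 (proof) p. 195] -/
theorem hflip_of_antiOriented {ι : Type*} (s : Finset ι)
    (u' : ι → ↥(cmBorelTriple L 2 v).M × (cmDatum L 1 (Matrix.of fun i j : Fin 1 => if i.val + j.val + 1 = 1 then (1 : L) else 0)).Local v)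
    (S' : Subgroup (↥(cmBorelTriple L 2 v).M × (cmDatum L 1 (Matrix.of fun i j : Fin 1 => if i.val + j.val + 1 = 1 then (1 : L) else 0)).Local v))
    (C' : ι → Set (↥(cmBorelTriple L 2 v).M × (cmDatum L 1 (Matrix.of fun i j : Fin 1 => if i.val + j.val + 1 = 1 then (1 : L) else 0)).Local v))
    (hC' : ∀ j ∈ s, C' j = u' j • (S' : Set (↥(cmBorelTriple L 2 v).M × (cmDatum L 1 (Matrix.of fun i j : Fin 1 => if i.val + j.val + 1 = 1 then (1 : L) else 0)).Local v)))
    (hanti : ∀ j ∈ s, ∀ e : Fin 2 → (LocalRing L v)ˣ,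
      glDiagonal 2 (LocalRing L v) e = (((u' j).1 : ↥(unitaryGroupOfForm (conjLocal L (IsCMField.complexConj L) v) (cmLocalForm L 2 v))) : GL (Fin 2) (LocalRing L v)) →
      Valued.v (((e 0 : (LocalRing L v)ˣ) : LocalRing L v) w) < Valued.v (((e 1 : (LocalRing L v)ˣ) : LocalRing L v) w))
    (hbox : ∀ k ∈ S', ∀ e : Fin 2 → (LocalRing L v)ˣ,
      glDiagonal 2 (LocalRing L v) e = ((k.1 : ↥(unitaryGroupOfForm (conjLocal L (IsCMField.complexConj L) v) (cmLocalForm L 2 v))) : GL (Fin 2) (LocalRing L v)) →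
      ∀ i, Valued.v (((e i : (LocalRing L v)ˣ) : LocalRing L v) w - 1) < 1) :
    ∀ (γH : ((cmDatum L 2 (Matrix.of fun i j : Fin 2 => if i.val + j.val + 1 = 2 then (1 : L) else 0)).Local v × (cmDatum L 1 (Matrix.of fun i j : Fin 1 => if i.val + j.val + 1 = 1 then (1 : L) else 0)).Local v))
      (d' : Fin 2 → (LocalRing L v)ˣ), glDiagonal 2 (LocalRing L v) d' = ((γH.1).val : GL (Fin 2) (LocalRing L v)) → IsLocalGRegular L v γH →
      Valued.v (((d' 1 : (LocalRing L v)ˣ) : LocalRing L v) w) < Valued.v (((d' 0 : (LocalRing L v)ˣ) : LocalRing L v) w) →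
      galAdicCompletionMap (L := L) (IsCMField.complexConj L) hw (((d' 0 : (LocalRing L v)ˣ) : LocalRing L v) w) * ((d' 1 : (LocalRing L v)ˣ) : LocalRing L v) w = 1 →
      ∀ (tH : ↥(cmBorelTriple L 2 v).M), (tH : ↥(unitaryGroupOfForm (conjLocal L (IsCMField.complexConj L) v) (cmLocalForm L 2 v))) = γH.1 →
      ∀ j ∈ s, (tH, γH.2) ∉ C' j := by
  intro γH d' hd' _hreg hlt _h01 tH htH j hj hmem
  rw [hC' j hj, Set.mem_smul_set] at hmem
  obtain ⟨k, hkS, hk⟩ := hmem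
  rw [smul_eq_mul] at hk
  have hk1 : (u' j).1 * k.1 = tH := by rw [← Prod.fst_mul, hk]
  obtain ⟨eu, heu⟩ := (mem_torusU_iff _).1 (u' j).1.2
  obtain ⟨ek, hek⟩ := (mem_torusU_iff _).1 k.1.2
  have hmul : glDiagonal 2 (LocalRing L v) d' = glDiagonal 2 (LocalRing L v) eu * glDiagonal 2 (LocalRing L v) ek := by
    rw [hd', heu, hek, ← htH, ← hk1]; rfl
  have h0 := coe_apply_eq_mul_of_glDiagonal_mul hmul 0
  have h1 := coe_apply_eq_mul_of_glDiagonal_mul hmul 1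
  have hk0 : Valued.v (((ek 0 : (LocalRing L v)ˣ) : LocalRing L v) w) = 1 := by
    have e := Valuation.map_one_add_of_lt _ (hbox k hkS ek hek 0)
    rwa [add_sub_cancel] at e
  have hk1' : Valued.v (((ek 1 : (LocalRing L v)ˣ) : LocalRing L v) w) = 1 := by
    have e := Valuation.map_one_add_of_lt _ (hbox k hkS ek hek 1)
    rwa [add_sub_cancel] at e
  have hd0 : Valued.v (((d' 0 : (LocalRing L v)ˣ) : LocalRing L v) w) = Valued.v (((eu 0 : (LocalRing L v)ˣ) : LocalRing L v) w) := by
    rw [h0, Pi.mul_apply, Valuation.map_mul, hk0, mul_one]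
  have hd1 : Valued.v (((d' 1 : (LocalRing L v)ˣ) : LocalRing L v) w) = Valued.v (((eu 1 : (LocalRing L v)ˣ) : LocalRing L v) w) := by
    rw [h1, Pi.mul_apply, Valuation.map_mul, hk1', mul_one]
  have hanti' := hanti j hj eu heu
  rw [← hd0, ← hd1] at hanti'
  exact lt_asymm hlt hanti'

end Flip

end Summit.HodgeConjecture.HodgeConjecture.Cruxes.H413.F0P3cStCharTSShellOn
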